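import Literature.AlgebraicGeometry.HodgeTheory.WeilClassesCyclicPrymDegreeSeven
import Literature.AlgebraicGeometry.HodgeTheory.WeilClassesCyclicPrymTyping
import HarnessLib

/-!
# Schoen's cyclic Prym fact in degree `7`, typed: each of the six eigenspaces is at most a line

Topic `AlgebraicGeometry/HodgeTheory`; namespace `Literature.AlgebraicGeometry.HodgeTheory`.
Theorem-only companion (no definition, no named fact, sorry-free) of the named fact
`Schoen1988_cyclicPrym_weilClasses_algebraic_degreeSeven` (`WeilClassesCyclicPrymDegreeSeven.lean`;
C. Schoen, Compositio Math. 65 (1988), Cor. 3.1 (p. 24) with Thm. 2.0 (p. 11, proof for `r = 0`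
p. 13) at `(q, m, r) = (7, 7, 0)` = D. Patel–Y. Zhang, arXiv:2506.13729, Thm. 1.2 / Thm. 5.3 with
Lemma 5.1 at `G = ℤ/7`, `g(C') = 7`, `h = 12`): on the Prym `36`-fold `B = (ker Σ_{i<7} σ_*ⁱ)⁰` of an
étale `ℤ/7`-cover `C → C'` of a genus-`7` curve, every class of each typed eigenspace
`E_a := Eig((2·𝟙_B + s_B)^*|H¹²(B(ℂ); ℂ), (2 + ζ₇^a)¹²)`, `1 ≤ a ≤ 6`, is algebraic.

Exactly as for the degree-`6` / degree-`3` siblings (`WeilClassesCyclicPrymTyping/…/DegreeThree`),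
what is PROVED here is the cohomological TYPING half of the fact's dictionary and the reduction of
the fact to the two inputs the printed proof actually supplies:

* §1 `prod_two_add_eq_pow_twelve_iff` (arithmetic of the typing): twelve 7th roots of unity `λᵢ`
  have `∏ᵢ (2 + λᵢ) = (2 + ζ₇^a)¹²` iff all `λᵢ = ζ₇^a` — `N(2 + ζ₇) = Φ₇(-2) = 43` is a prime
  `≡ 1 (mod 7)`, so the six conjugates `2 + ζ₇^b` generate DISTINCT degree-one primes of `ℤ[ζ₇]`
  (reduction `ζ₇ ↦ r_b ∈ 𝔽₄₃`, kernel `decide`; the passage `ℂ → ℤ[ζ₇] → 𝔽₄₃` is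
  `minpoly_ℤ ζ₇ = Φ₇`).
* §3 **`finrank_eigenspace_two_add_pow_twelve_le_one`** (the typing): for ANY endomorphism `t` of a
  complex abelian variety `A` with `t⁷ = 𝟙` and any `1 ≤ a ≤ 6`, if the `ζ₇^a`-eigenspace of `t^*`
  on `H¹(A(ℂ); ℂ)` has dimension `≤ 12` then `Eig((2·𝟙_A + t)^*|H¹², (2 + ζ₇^a)¹²)` has dimension
  `≤ 1`: `t^*` is diagonalisable on `H¹` (`X⁷ - 1` is separable; Mathlib
  `Module.End.isSemisimple_of_squarefree_aeval_eq_zero`, `IsSemisimple.iSup_eigenspace_eq_top`), the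
  wedge basis of `H¹² = ⋀¹² H¹` (`Motives.AbelianVariety.hasExteriorCohomologyH1_complexPoints`, a
  THEOREM) diagonalises `(2·𝟙 + t)^* = ⋀¹²(2 + t^*)` (`complexBetti_map_add_one`: pull-back is
  additive on `H¹`) with eigenvalues `∏ᵢ (2 + λᵢ)`, and by §1 the eigenvalue `(2 + ζ₇^a)¹²` occurs
  only on the pure wedges `⌣_{i ∈ S} bᵢ`, `S ⊆ {i | λᵢ = ζ₇^a}`, `|S| = 12` — at most ONE such `S`.
  This is the TYPING paragraph of the fact ("`Eig((2·𝟙_B + s_B)^*, (2 + ζ₇^a)¹²) = ⋀¹² H¹_{ζ₇^a}`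
  EXACTLY"), for `t = s_B` (`s_B⁷ = 𝟙`, `kerComponent_restrict_comp_pow_seven`).
* §4 **`Schoen1988_cyclicPrym_weilClasses_algebraic_degreeSeven_of_finrank_le_of_exists`**: the fact
  FOLLOWS from (P2) the Chevalley–Weil bound `dim H¹(B(ℂ); ℂ)_{ζ₇^a} ≤ 12` for the `s_B^*`-eigenspaces
  (Patel–Zhang Lemma 2.9 / Cor. 2.10 / Lemma 5.1: multiplicity `h = 12` of every non-trivial
  character in `H¹(C) ⊇ H¹(B)`; in the tree this needs `H¹(J(C)) ≅ H¹(C)` — the named fact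
  `Motives.isIso_bettiCohomology_map_abelJacobi` — and the Lefschetz numbers of the free `σʲ`), and
  (P3) ONE non-zero algebraic class in each `E_a` — Schoen's cycle `z_χ` (Thm. 2.0, `r = 0`, p. 13:
  a component `Q` of the étale pull-back of `|K_{C'}| ≅ ℙ⁶ ⊂ S¹²C'` to `W₀ = G∖C¹²`, non-zero because
  `c₆(N_{Q/W₀}) ≠ 0`, Lemma 2.6) pushed to `B` by Poincaré's formula and Lieberman's theorem
  (Cor. 3.1, p. 25): symmetric powers with their Abel–Jacobi bundle structure and the hard-Lefschetz
  inverse, NONE of which the tree has; and `…_of_finrank_le_of_exists_three`: by complex conjugation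
  (`conjClass` maps `E_a` onto `E_{7-a}` and preserves algebraic classes) the classes for `a = 1, 2, 3`
  suffice.

## References

* [Schoen1988HodgeWeil] C. Schoen, *Hodge classes on self-products of a variety with an
  automorphism*, Compositio Math. 65 (1988) 3–32: Lemma 1.2, Lemma 1.5, Thm. 2.0 (p. 11; proof for
  `r = 0`, p. 13), Lemma 2.6, §3 Cor. 3.1 (pp. 24–25). Read on Numdam.
* [PatelZhang2025PrymHodge] D. Patel, Y. Zhang, arXiv:2506.13729 (2025): Thm. 1.2, §2.6, Lemma 2.9,
  Cor. 2.10, Lemma 5.1, Thm. 5.3.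
* [vanGeemen1994HodgeAV] B. van Geemen, LNM 1594 (1994), 4.9 and proof of Thm. 6.12 (wedge bases).
* [VoisinHodgeI2002] C. Voisin, *Hodge Theory and Complex Algebraic Geometry I* (2002), Cor. 6.12.
-/

noncomputable section

open CategoryTheory Polynomial

namespace Literature.AlgebraicGeometry.HodgeTheory

open Literature.AlgebraicTopology.SingularHomology
open Literature.AlgebraicGeometry Literature.AlgebraicGeometry.Motives

/-! ### §1 Arithmetic of the typing: twelve 7th roots of unity are pinned by `∏ᵢ (2 + λᵢ)`

On a wedge `b_{i₁} ⌣ ⋯ ⌣ b_{i₁₂}` of `s_B^*`-eigenvectors (`s_B^{*7} = 1`, eigenvalues `λᵢ`,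
`λᵢ⁷ = 1`) the operator `⋀¹²(2 + s_B^*)` acts by `∏ᵢ (2 + λᵢ)`; that this is `(2 + ζ₇^a)¹²`
(`1 ≤ a ≤ 6`) only when all `λᵢ = ζ₇^a` is proved here.  Mechanism: `N_{ℚ(ζ₇)/ℚ}(2 + ζ₇) =
Φ₇(-2) = 43`, a prime `≡ 1 (mod 7)`, so the six conjugates `2 + ζ₇^c` generate six DISTINCT
degree-one primes `𝔭_c` of `ℤ[ζ₇]`; the reduction `ζ₇ ↦ r_c ∈ 𝔽₄₃` modulo `𝔭_c`
(`r_c = 41, 16, 11, 4, 35, 21`, the root of `Φ₇` with `r_c^c = 41 = -2`; `exists_zmod43_root`,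
kernel `decide`) kills `2 + ζ₇^c` and makes `2 + ζ₇^b`, `0 ≤ b ≤ 6`, `b ≠ c`, a unit.  The passage
`ℂ → ℤ[ζ₇] → 𝔽₄₃` is `minpoly_ℤ ζ₇ = Φ₇` (`aeval_eq_zero_of_aeval_zeta7_eq_zero`).  The eigenvalue
`1` (`2 + 1 = 3`) is excluded by a second reduction (`3ᵏ = (2 + ζ₇^a)ᵏ ⇒ 3ᵏ ≡ 0 (mod 𝔭_a)`), so
only `λᵢ⁷ = 1` is needed, not `Φ₇(λᵢ) = 0`.  (The same certificate in multi-index form is the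
summit-side refuter lemma `twoAddZeta7_prod_eq_pow_iff`; nothing is imported from there.) -/

section SeparationSeven

open Polynomial

/-- `exp(2πi/7)` is a primitive 7th root of unity. [folklore] -/
theorem isPrimitiveRoot_exp_two_pi_I_div_seven :
    IsPrimitiveRoot (Complex.exp (2 * (Real.pi : ℂ) * Complex.I / 7)) 7 := by
  simpa using Complex.isPrimitiveRoot_exp 7 (by norm_num)

/-- `2 + ζ₇^a ≠ 0` (`|ζ₇^a| = 1 ≠ 2`): the test endomorphism `2·𝟙_B + s_B` is injective on `H¹`.
[folklore] -/
theorem two_add_zeta7_pow_ne_zero {ζ : ℂ} (hζ : IsPrimitiveRoot ζ 7) (a : ℕ) :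
    (2 : ℂ) + ζ ^ a ≠ 0 := by
  intro h
  have h1 : ‖ζ ^ a‖ = 1 := by
    rw [norm_pow, hζ.norm'_eq_one (by norm_num), one_pow]
  rw [eq_neg_of_add_eq_zero_right h, norm_neg] at h1
  norm_num at h1

/-- **`ℂ → ℤ[ζ₇] → R`.** An integer polynomial vanishing at `ζ₇` is divisible by
`Φ₇ = minpoly_ℤ ζ₇` (`ℤ` is integrally closed), hence vanishes at every root of
`Φ₇ = 1 + X + ⋯ + X⁶` in any commutative ring `R` (below: `R = ZMod 43`). [folklore] -/
theorem aeval_eq_zero_of_aeval_zeta7_eq_zero {ζ : ℂ} (hζ : IsPrimitiveRoot ζ 7) {P : ℤ[X]}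
    (hP : aeval ζ P = 0) {R : Type*} [CommRing R] {r : R}
    (hr : 1 + r + r ^ 2 + r ^ 3 + r ^ 4 + r ^ 5 + r ^ 6 = 0) : aeval r P = 0 := by
  have hdvd : cyclotomic 7 ℤ ∣ P := by
    rw [cyclotomic_eq_minpoly hζ (by norm_num)]
    exact minpoly.isIntegrallyClosed_dvd (hζ.isIntegral (by norm_num)) hP
  obtain ⟨Q, rfl⟩ := hdvd
  haveI : Fact (Nat.Prime 7) := ⟨by norm_num⟩
  have h7 : aeval r (cyclotomic 7 ℤ) = 1 + r + r ^ 2 + r ^ 3 + r ^ 4 + r ^ 5 + r ^ 6 := by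
    rw [aeval_def, ← Polynomial.eval_map, map_cyclotomic, cyclotomic_prime, eval_finsetSum]
    simp only [eval_pow, eval_X, Finset.sum_range_succ, Finset.sum_range_zero]
    ring
  rw [map_mul, h7, hr, zero_mul]

/-- **The six primes of `ℤ[ζ₇]` over `43 = Φ₇(-2)` are distinct**, as a finite check in `𝔽₄₃`: for
each `c ∈ {1, …, 6}` there is a root `r` of `Φ₇` in `ZMod 43` (namely `r_c = 41, 16, 11, 4, 35, 21`,
the reduction of `ζ₇` modulo `𝔭_c = (2 + ζ₇^c)`) with `2 + r^c = 0` and `2 + r^b ≠ 0` for every other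
`b ∈ {0, …, 6}` (kernel `decide`). [folklore] -/
theorem exists_zmod43_root : ∀ c ∈ Finset.Icc 1 6, ∃ r : ZMod 43,
    1 + r + r ^ 2 + r ^ 3 + r ^ 4 + r ^ 5 + r ^ 6 = 0 ∧ (2 : ZMod 43) + r ^ c = 0 ∧
      ∀ b ∈ Finset.range 7, b ≠ c → (2 : ZMod 43) + r ^ b ≠ 0 := by
  decide

/-- **Separation, exponent form.** If `e₁, …, e₁₂ ∈ {0, …, 6}`, `1 ≤ a ≤ 6` and
`∏ᵢ (2 + ζ₇^{eᵢ}) = (2 + ζ₇^a)¹²`, then `eᵢ = a` for every `i`: first `eᵢ ∈ {0, a}` (reduce modulo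
`𝔭_{eᵢ}`, which kills the product but not `(2 + ζ₇^a)¹²`), then no `eᵢ = 0` (else
`3ᵏ = (2 + ζ₇^a)ᵏ`, `k ≥ 1`, which dies modulo `𝔭_a` while `3` is a unit in `𝔽₄₃`). [folklore] -/
theorem forall_eq_of_prod_two_add_zeta7_pow_eq {ζ : ℂ} (hζ : IsPrimitiveRoot ζ 7) {e : Fin 12 → ℕ}
    (he : ∀ i, e i < 7) {a : ℕ} (ha₁ : 1 ≤ a) (ha₆ : a ≤ 6)
    (h : ∏ i, (2 + ζ ^ e i) = (2 + ζ ^ a) ^ 12) : ∀ i, e i = a := by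
  classical
  have h3 : (3 : ZMod 43) ≠ 0 := by decide
  haveI : Fact (Nat.Prime 43) := ⟨by norm_num⟩
  have ha : a ∈ Finset.Icc 1 6 := Finset.mem_Icc.mpr ⟨ha₁, ha₆⟩
  -- Step 1: every exponent is `0` or `a`.
  have step1 : ∀ i, e i = 0 ∨ e i = a := by
    intro i
    by_contra hnot
    push Not at hnot
    obtain ⟨r, hsum, hcc, hother⟩ :=
      exists_zmod43_root (e i) (Finset.mem_Icc.mpr ⟨Nat.one_le_iff_ne_zero.mpr hnot.1, by
        have := he i; omega⟩)
    have hP : aeval ζ ((∏ j, (C 2 + X ^ e j)) - (C 2 + X ^ a) ^ 12 : ℤ[X]) = 0 := by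
      simp only [map_sub, map_prod, map_add, map_pow, aeval_X, map_ofNat, h, sub_self]
    have h0 := aeval_eq_zero_of_aeval_zeta7_eq_zero hζ hP hsum
    simp only [map_sub, map_prod, map_add, map_pow, aeval_X, map_ofNat, sub_eq_zero] at h0
    have hL : ∏ j, ((2 : ZMod 43) + r ^ e j) = 0 := Finset.prod_eq_zero (Finset.mem_univ i) hcc
    have hR : ((2 : ZMod 43) + r ^ a) ^ 12 ≠ 0 :=
      pow_ne_zero _ (hother a (Finset.mem_range.mpr (by omega)) (Ne.symm hnot.2))
    rw [h0] at hL
    exact hR hL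
  -- Step 2: no exponent is `0`.
  have hsplit : ∏ i, (2 + ζ ^ e i) =
      3 ^ (Finset.univ.filter fun i : Fin 12 => e i = 0).card *
        (2 + ζ ^ a) ^ (Finset.univ.filter fun i : Fin 12 => ¬ e i = 0).card := by
    rw [← Finset.prod_filter_mul_prod_filter_not Finset.univ (fun i : Fin 12 => e i = 0)]
    congr 1
    · rw [Finset.prod_congr rfl (fun i hi => by rw [(Finset.mem_filter.mp hi).2, pow_zero]),
        Finset.prod_const]
      norm_num
    · rw [Finset.prod_congr rfl (fun i hi => by
        rw [(step1 i).resolve_left (Finset.mem_filter.mp hi).2]), Finset.prod_const]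
  set k := (Finset.univ.filter fun i : Fin 12 => e i = 0).card with hkdef
  set l := (Finset.univ.filter fun i : Fin 12 => ¬ e i = 0).card with hldef
  have hkl : k + l = 12 := by
    rw [hkdef, hldef, Finset.card_filter_add_card_filter_not, Finset.card_univ, Fintype.card_fin]
  have hk3 : (3 : ℂ) ^ k = (2 + ζ ^ a) ^ k := by
    have h' : (3 : ℂ) ^ k * (2 + ζ ^ a) ^ l = (2 + ζ ^ a) ^ k * (2 + ζ ^ a) ^ l := by
      rw [← hsplit, h, ← pow_add, hkl]
    exact mul_right_cancel₀ (pow_ne_zero l (two_add_zeta7_pow_ne_zero hζ a)) h'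
  have hk0 : k = 0 := by
    by_contra hk
    obtain ⟨r, hsum, haa, -⟩ := exists_zmod43_root a ha
    have hQ : aeval ζ ((C 3) ^ k - (C 2 + X ^ a) ^ k : ℤ[X]) = 0 := by
      simp only [map_sub, map_pow, map_add, aeval_X, map_ofNat, hk3, sub_self]
    have h0 := aeval_eq_zero_of_aeval_zeta7_eq_zero hζ hQ hsum
    simp only [map_sub, map_pow, map_add, aeval_X, map_ofNat] at h0
    rw [haa, zero_pow hk, sub_zero] at h0
    exact pow_ne_zero k h3 h0
  intro i
  rcases step1 i with h0 | hia
  · exfalso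
    have hi : i ∈ Finset.univ.filter (fun i : Fin 12 => e i = 0) :=
      Finset.mem_filter.mpr ⟨Finset.mem_univ _, h0⟩
    rw [Finset.card_eq_zero.mp hk0] at hi
    exact Finset.notMem_empty _ hi
  · exact hia

/-- **Separation, root-of-unity form** (the shape met on a wedge basis of `H¹² = ⋀¹² H¹`): twelve
complex numbers `λᵢ` with `λᵢ⁷ = 1` have `∏ᵢ (2 + λᵢ) = (2 + ζ₇^a)¹²` (`1 ≤ a ≤ 6`) iff every `λᵢ`
equals `ζ₇^a`.  Hence, on `⋀¹² H¹(B)` with `H¹(B) = ⊕_b H¹_{ζ₇^b}`, the eigenspace of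
`⋀¹²(2 + s_B^*)` for `(2 + ζ₇^a)¹²` is spanned by the wedges with all twelve factors in `H¹_{ζ₇^a}` —
the TYPING of the fact ("`Eig((2·𝟙_B + s_B)^*, (2 + ζ₇^a)¹²) = ⋀¹² H¹_{ζ₇^a}` EXACTLY").
[folklore] -/
theorem prod_two_add_eq_pow_twelve_iff {ζ : ℂ} (hζ : IsPrimitiveRoot ζ 7) {lam : Fin 12 → ℂ}
    (hlam : ∀ i, lam i ^ 7 = 1) {a : ℕ} (ha₁ : 1 ≤ a) (ha₆ : a ≤ 6) :
    ∏ i, (2 + lam i) = (2 + ζ ^ a) ^ 12 ↔ ∀ i, lam i = ζ ^ a := by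
  constructor
  · intro h
    choose e he hlam' using fun i => hζ.eq_pow_of_pow_eq_one (hlam i)
    have h' : ∏ i, (2 + ζ ^ e i) = (2 + ζ ^ a) ^ 12 := by
      rw [← h]
      exact Finset.prod_congr rfl fun i _ => by rw [hlam' i]
    intro i
    rw [← hlam' i, forall_eq_of_prod_two_add_zeta7_pow_eq hζ he ha₁ ha₆ h' i]
  · intro h
    rw [Finset.prod_congr rfl fun i _ => by rw [h i], Finset.prod_const, Finset.card_univ,
      Fintype.card_fin]

end SeparationSeven

/-! ### §2 Linear algebra: eigenvalues of finite-order operators; lines -/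

section LinearAlgebra

variable {K V : Type*} [Field K] [AddCommGroup V] [Module K V]

/-- `T v = μ v ⟹ Tⁿ v = μⁿ v`. [folklore] -/
theorem pow_apply_of_mem_eigenspace {T : Module.End K V} {μ : K} {v : V}
    (hv : v ∈ T.eigenspace μ) (n : ℕ) : (T ^ n) v = μ ^ n • v := by
  induction n with
  | zero => simp
  | succ n ih =>
    rw [pow_succ', Module.End.mul_apply, ih, map_smul, Module.End.mem_eigenspace_iff.mp hv,
      smul_smul, ← pow_succ]

/-- The eigenvalue of a non-zero eigenvector of an operator `T` with `Tⁿ = 1` is an `n`-th root of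
unity. [folklore] -/
theorem pow_eq_one_of_mem_eigenspace {T : Module.End K V} {n : ℕ} (hT : T ^ n = 1) {μ : K} {v : V}
    (hv : v ∈ T.eigenspace μ) (hv0 : v ≠ 0) : μ ^ n = 1 := by
  have h := pow_apply_of_mem_eigenspace hv n
  rw [hT, Module.End.one_apply] at h
  have h2 : (μ ^ n - 1) • v = 0 := by rw [sub_smul, one_smul, ← h, sub_self]
  exact sub_eq_zero.mp ((smul_eq_zero.mp h2).resolve_right hv0)

/-- A subspace of dimension `≤ 1` containing a non-zero vector `z` is the line through `z`; in
particular it lies in every subspace containing `z`. [folklore] -/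
theorem le_of_finrank_le_one_of_mem {W U : Submodule K V} [FiniteDimensional K W]
    (hW : Module.finrank K W ≤ 1) {z : V} (hzW : z ∈ W) (hz0 : z ≠ 0) (hzU : z ∈ U) : W ≤ U := by
  have hz0' : (⟨z, hzW⟩ : W) ≠ 0 := fun h => hz0 (by simpa using congrArg Subtype.val h)
  have hpos : 0 < Module.finrank K W := Module.finrank_pos_iff_exists_ne_zero.mpr ⟨_, hz0'⟩
  have h1 : Module.finrank K W = 1 := le_antisymm hW hpos
  intro w hw
  obtain ⟨c, hc⟩ := (finrank_eq_one_iff_of_nonzero' (⟨z, hzW⟩ : W) hz0').mp h1 ⟨w, hw⟩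
  have hc' : c • z = w := by simpa using congrArg Subtype.val hc
  rw [← hc']
  exact U.smul_mem c hzU

end LinearAlgebra

/-! ### §3 The typing: `Eig((2·𝟙_A + t)^*|H¹², (2 + ζ₇^a)¹²)` is at most a line -/

section TypedLine

variable {A : Motives.AbelianVariety ℂ}

/-- On an eigenvector `c ∈ ker(φ^* - μ)` of `H¹` the test endomorphism `x·𝟙 + y·φ`, `x y : ℤ`, acts
by `(x·𝟙 + y·φ)^* c = (x + y μ) c` (the `ℤ`-version of
`complexBetti_map_nsmul_id_add_nsmul_one_of_mem_eigenspace`: pull-back is additive on `H¹`).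
[cite: vanGeemen1994HodgeAV, 4.8–4.9] -/
theorem complexBetti_map_zsmul_id_add_zsmul_one_of_mem_eigenspace {φ : A ⟶ A} {μ : ℂ}
    {c : complexBetti A.X 1}
    (hc : c ∈ Module.End.eigenspace (complexBetti.map φ.hom.hom.hom 1).hom μ) (x y : ℤ) :
    complexBetti.map (x • 𝟙 A + y • φ).hom.hom.hom 1 c = ((x : ℂ) + (y : ℂ) * μ) • c := by
  rw [complexBetti_map_zsmul_id_add_zsmul_one]
  rw [Module.End.mem_eigenspace_iff] at hc
  change (x : ℂ) • c + (y : ℂ) • (complexBetti.map φ.hom.hom.hom 1).hom c = _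
  rw [hc, smul_smul, ← add_smul]

/-- `(t^*)⁷ = 1` on `H¹(A(ℂ); ℂ)` for `t⁷ = 𝟙_A` (functoriality). [folklore] -/
theorem complexBetti_map_one_hom_pow_seven {t : A ⟶ A}
    (ht : t ≫ t ≫ t ≫ t ≫ t ≫ t ≫ t = 𝟙 A) : (complexBetti.map t.hom.hom.hom 1).hom ^ 7 = 1 := by
  have hc : ∀ f g : A ⟶ A, (complexBetti.map (f ≫ g).hom.hom.hom 1).hom =
      (complexBetti.map f.hom.hom.hom 1).hom ∘ₗ (complexBetti.map g.hom.hom.hom 1).hom := by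
    intro f g
    change (complexBetti.map (f.hom.hom.hom ≫ g.hom.hom.hom) 1).hom = _
    rw [complexBetti.map_comp, ModuleCat.hom_comp]
  have h := congrArg (fun u : A ⟶ A => (complexBetti.map u.hom.hom.hom 1).hom) ht
  dsimp only at h
  iterate 6 rw [hc] at h
  change _ = (complexBetti.map (𝟙 A.X) 1).hom at h
  rw [complexBetti.map_id, ModuleCat.hom_id, ← Module.End.one_eq_id] at h
  rw [← h]
  simp only [pow_succ, pow_zero, one_mul, Module.End.mul_eq_comp, LinearMap.comp_assoc]

/-- **The typed eigenspace is at most a line.**  Let `t` be an endomorphism of a complex abelian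
variety `A` with `t⁷ = 𝟙` and `1 ≤ a ≤ 6`.  If the `ζ₇^a`-eigenspace of `t^*` on `H¹(A(ℂ); ℂ)` has
dimension `≤ 12`, then the eigenspace of the single pull-back `(2·𝟙_A + t)^*` on `H¹²(A(ℂ); ℂ)` for
`(2 + ζ₇^a)¹²` has dimension `≤ 1`.  Proof (van Geemen 4.9 / proof of Thm. 6.12, with seven
characters instead of two): `t^*` is diagonalisable on `H¹` (`(t^*)⁷ = 1`, `X⁷ - 1` separable); in an
eigenbasis `b` the wedge basis `b_S = ⌣_{i ∈ S} bᵢ` of `H¹² = ⋀¹² H¹`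
(`Motives.AbelianVariety.hasExteriorCohomologyH1_complexPoints`) diagonalises
`(2·𝟙 + t)^* = ⋀¹²(2 + t^*)` with eigenvalue `∏_{i ∈ S} (2 + λᵢ)`, which is `(2 + ζ₇^a)¹²` iff all
twelve `λᵢ = ζ₇^a` (`prod_two_add_eq_pow_twelve_iff`); such `S` are 12-subsets of
`{i | λᵢ = ζ₇^a}`, a set of `≤ 12` indices — at most one.  (With "`= 12`" in the hypothesis the
eigenspace is exactly the line `⋀¹² H¹_{ζ₇^a}` of the fact's TYPING paragraph; with "`< 12`" it is
`0`.) [cite: vanGeemen1994HodgeAV, 4.9 and proof of Thm. 6.12]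
[cite: PatelZhang2025PrymHodge, §2.6 (p. 7)] -/
theorem finrank_eigenspace_two_add_pow_twelve_le_one {ζ : ℂ} (hζ : IsPrimitiveRoot ζ 7) {t : A ⟶ A}
    (ht : t ≫ t ≫ t ≫ t ≫ t ≫ t ≫ t = 𝟙 A) {a : ℕ} (ha₁ : 1 ≤ a) (ha₆ : a ≤ 6)
    (hmult : Module.finrank ℂ
      (Module.End.eigenspace (complexBetti.map t.hom.hom.hom 1).hom (ζ ^ a)) ≤ 12) :
    Module.finrank ℂ (Module.End.eigenspace
      (complexBetti.map ((2 : ℤ) • 𝟙 A + t).hom.hom.hom 12).hom ((2 + ζ ^ a) ^ 12)) ≤ 1 := by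
  classical
  haveI := finite_complexBetti_abelianVariety A 1
  haveI := finite_complexBetti_abelianVariety A 12
  have hΛ := Motives.AbelianVariety.hasExteriorCohomologyH1_complexPoints A
  set T : Module.End ℂ (complexBetti A.X 1) := (complexBetti.map t.hom.hom.hom 1).hom with hT
  have hT7 : T ^ 7 = 1 := complexBetti_map_one_hom_pow_seven ht
  -- `t^*` is diagonalisable: `H¹ = ⊕_μ Eig(T, μ)`
  have hss : T.IsSemisimple := by
    refine Module.End.isSemisimple_of_squarefree_aeval_eq_zero
      (Polynomial.separable_X_pow_sub_C (1 : ℂ) (n := 7) (by norm_num) one_ne_zero).squarefree ?_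
    simp only [map_sub, map_pow, aeval_X, map_one, hT7, sub_self]
  have htop : ⨆ μ, T.eigenspace μ = ⊤ := hss.iSup_eigenspace_eq_top
  have hint : DirectSum.IsInternal T.eigenspace :=
    DirectSum.isInternal_submodule_of_iSupIndep_of_iSup_eq_top T.eigenspaces_iSupIndep htop
  -- an eigenbasis of `H¹`, reindexed by `Fin N`
  let bE : ∀ μ : ℂ, Module.Basis (Fin (Module.finrank ℂ (T.eigenspace μ))) ℂ (T.eigenspace μ) :=
    fun μ => Module.finBasis ℂ _
  let b₀ := hint.collectedBasis bE
  letI : Fintype (Σ μ : ℂ, Fin (Module.finrank ℂ (T.eigenspace μ))) :=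
    FiniteDimensional.fintypeBasisIndex b₀
  let e : (Σ μ : ℂ, Fin (Module.finrank ℂ (T.eigenspace μ))) ≃
      Fin (Fintype.card (Σ μ : ℂ, Fin (Module.finrank ℂ (T.eigenspace μ)))) := Fintype.equivFin _
  set N := Fintype.card (Σ μ : ℂ, Fin (Module.finrank ℂ (T.eigenspace μ))) with hN
  let b : Module.Basis (Fin N) ℂ (complexBetti A.X 1) := b₀.reindex e
  let lam : Fin N → ℂ := fun i => (e.symm i).1
  have hb_mem : ∀ i, b i ∈ T.eigenspace (lam i) := by
    intro i
    rw [Module.Basis.reindex_apply]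
    exact hint.collectedBasis_mem bE (e.symm i)
  have hlam7 : ∀ i, lam i ^ 7 = 1 := fun i =>
    pow_eq_one_of_mem_eigenspace hT7 (hb_mem i) (b.ne_zero i)
  -- the test pull-back on the eigenbasis of `H¹`
  have hact1 : ∀ i, complexBetti.map ((2 : ℤ) • 𝟙 A + t).hom.hom.hom 1 (b i) = (2 + lam i) • b i := by
    intro i
    have hop : (2 : ℤ) • 𝟙 A + t = (2 : ℤ) • 𝟙 A + (1 : ℤ) • t := by rw [one_zsmul]
    rw [hop, complexBetti_map_zsmul_id_add_zsmul_one_of_mem_eigenspace (hb_mem i)]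
    congr 1
    push_cast
    ring
  -- the wedge basis of `H¹²` and the action of the test pull-back on it
  let Bw : Module.Basis (Set.powersetCard (Fin N) 12) ℂ (complexBetti A.X 12) :=
    (b.exteriorPower 12).map (hΛ.equiv 12)
  have hBw : ∀ S, Bw S = cupPowOne ℂ (Motives.ComplexPoints A.X) 12
      (b ∘ (Set.powersetCard.ofFinEmbEquiv.symm S)) := by
    intro S
    change hΛ.equiv 12 ((b.exteriorPower 12) S) = _
    rw [exteriorPower.basis_apply, HasExteriorCohomologyH1.equiv_apply, exteriorPower.ιMulti_family,
      wedgeToCup_ιMulti]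
  have hact : ∀ S : Set.powersetCard (Fin N) 12,
      (complexBetti.map ((2 : ℤ) • 𝟙 A + t).hom.hom.hom 12).hom (Bw S) =
        (∏ i : Fin 12, (2 + lam (Set.powersetCard.ofFinEmbEquiv.symm S i))) • Bw S := by
    intro S
    rw [hBw]
    change singularCohomology.map ℂ ℂ
      (Motives.AlgPoints.mapContinuous (L := ℂ) ((2 : ℤ) • 𝟙 A + t).hom.hom.hom) 12
        (cupPowOne ℂ _ 12 _) = _
    rw [map_cupPowOne]
    have e' : (fun i => singularCohomology.map ℂ ℂ
        (Motives.AlgPoints.mapContinuous (L := ℂ) ((2 : ℤ) • 𝟙 A + t).hom.hom.hom) 1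
          ((b ∘ (Set.powersetCard.ofFinEmbEquiv.symm S)) i)) =
        fun i => (2 + lam (Set.powersetCard.ofFinEmbEquiv.symm S i)) •
          (b ∘ (Set.powersetCard.ofFinEmbEquiv.symm S)) i := by
      funext i
      exact hact1 _
    rw [e', MultilinearMap.map_smul_univ]
  -- the typed eigenspace is the span of the PURE wedges (all twelve eigenvalues `ζ₇^a`)
  let good : Set (Set.powersetCard (Fin N) 12) :=
    {S | ∀ i : Fin 12, lam (Set.powersetCard.ofFinEmbEquiv.symm S i) = ζ ^ a}
  have hE : Module.End.eigenspace (complexBetti.map ((2 : ℤ) • 𝟙 A + t).hom.hom.hom 12).hom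
      ((2 + ζ ^ a) ^ 12) = Submodule.span ℂ (Bw '' good) := by
    ext c
    rw [Module.End.mem_eigenspace_iff]
    have h1 := forall_apply_eq_smul_iff_mem_span_image (P := Unit) Bw
      (fun _ => (complexBetti.map ((2 : ℤ) • 𝟙 A + t).hom.hom.hom 12).hom)
      (fun S _ => ∏ i : Fin 12, (2 + lam (Set.powersetCard.ofFinEmbEquiv.symm S i)))
      (fun _ S => hact S) (fun _ => (2 + ζ ^ a) ^ 12) c
    have hs : {S : Set.powersetCard (Fin N) 12 |
        (fun _ : Unit => ∏ i : Fin 12, (2 + lam (Set.powersetCard.ofFinEmbEquiv.symm S i))) =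
          fun _ : Unit => (2 + ζ ^ a) ^ 12} = good := by
      ext S
      simp only [Set.mem_setOf_eq, funext_iff, forall_const, good]
      exact prod_two_add_eq_pow_twelve_iff hζ (fun i => hlam7 _) ha₁ ha₆
    rw [hs] at h1
    rw [← h1]
    exact ⟨fun h _ => h, fun h => h ()⟩
  -- at most ONE pure index set: they are 12-subsets of `I = {i | λᵢ = ζ₇^a}`, `|I| ≤ 12`
  let I : Finset (Fin N) := Finset.univ.filter fun i => lam i = ζ ^ a
  have hIcard : I.card ≤ 12 := by
    have hli : LinearIndependent ℂ (fun i : I =>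
        (⟨b i, (Finset.mem_filter.mp i.2).2 ▸ hb_mem i⟩ : T.eigenspace (ζ ^ a))) := by
      apply LinearIndependent.of_comp (T.eigenspace (ζ ^ a)).subtype
      exact b.linearIndependent.comp (fun i : I => (i : Fin N)) Subtype.val_injective
    have h := hli.fintype_card_le_finrank
    rw [Fintype.card_coe] at h
    exact h.trans hmult
  have hsub : ∀ S ∈ good, (S : Finset (Fin N)) = I := by
    intro S hS
    apply Finset.eq_of_subset_of_card_le
    · intro j hj
      rw [Finset.mem_filter]
      refine ⟨Finset.mem_univ _, ?_⟩
      obtain ⟨i, rfl⟩ := (Set.powersetCard.mem_range_ofFinEmbEquiv_symm_iff_mem S j).2 hj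
      exact hS i
    · rw [Set.powersetCard.card_eq]
      exact hIcard
  have hgood : good.Subsingleton := fun S hS S' hS' =>
    Subtype.ext ((hsub S hS).trans (hsub S' hS').symm)
  -- conclude: the typed eigenspace is `0` or the line through the pure wedge
  rw [hE]
  rcases good.eq_empty_or_nonempty with hg | ⟨S₀, hS₀⟩
  · rw [hg, Set.image_empty, Submodule.span_empty, finrank_bot]
    exact zero_le_one
  · rw [hgood.eq_singleton_of_mem hS₀, Set.image_singleton, finrank_span_singleton (Bw.ne_zero S₀)]

/-- **Complex conjugation twists eigenvalues of pull-backs**: for an endomorphism `g` of `A` and any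
degree `k`, if `g^* c = w • c` then `g^* c̄ = w̄ • c̄` (`conjClass_map`, `conjClass_smul`); hence
conjugation maps the typed eigenspace `E_a` onto `E_{7-a}`. [cite: VoisinHodgeI2002, Cor. 6.12] -/
theorem conjClass_mem_eigenspace_complexBetti_map {g : A ⟶ A} {k : ℕ} {w : ℂ}
    {c : complexBetti A.X k} (hc : c ∈ Module.End.eigenspace (complexBetti.map g.hom.hom.hom k).hom w) :
    conjClass (Motives.ComplexPoints A.X) k c ∈
      Module.End.eigenspace (complexBetti.map g.hom.hom.hom k).hom (starRingEnd ℂ w) := by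
  rw [Module.End.mem_eigenspace_iff] at hc ⊢
  rw [← conjClass_smul, ← hc]
  exact (conjClass_map _ c).symm

/-- `conj ((2 + ζ₇^a)¹²) = (2 + ζ₇^{7-a})¹²` for `1 ≤ a ≤ 6` (`ζ̄₇ = ζ₇⁻¹ = ζ₇⁶`). [folklore] -/
theorem starRingEnd_two_add_zeta7_pow {ζ : ℂ} (hζ : IsPrimitiveRoot ζ 7) (a : ℕ) (ha₁ : 1 ≤ a)
    (ha₆ : a ≤ 6) : starRingEnd ℂ ((2 + ζ ^ a) ^ 12) = (2 + ζ ^ (7 - a)) ^ 12 := by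
  have h7 : ζ ^ 7 = 1 := hζ.pow_eq_one
  have hconj : starRingEnd ℂ ζ = ζ ^ 6 := by
    rw [← Complex.inv_eq_conj (hζ.norm'_eq_one (by norm_num))]
    exact inv_eq_of_mul_eq_one_right (by rw [← pow_succ', h7])
  have hpow : (ζ ^ 6) ^ a = ζ ^ (7 - a) := by
    rw [← pow_mul, show 6 * a = (7 - a) + 7 * (a - 1) by omega, pow_add, pow_mul, h7, one_pow,
      mul_one]
  simp only [map_pow, map_add, map_ofNat, hconj, hpow]

end TypedLine

/-! ### §4 Assembly: the fact from the Chevalley–Weil bound and Schoen's cycles -/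

section Assembly

/-- **`T₇ ⟸ (P2) ∧ (P3)`.**  The named fact
`Schoen1988_cyclicPrym_weilClasses_algebraic_degreeSeven` FOLLOWS from, for every instance of its
binders (`C`, `𝒥`, `σ` free of order `7`, `dim J(C) = 43`, `s = σ_*`, `e_N = Σ_{i<7} sⁱ`,
`B = (ker e_N)⁰`, `s_B` over `s`) and every `1 ≤ a ≤ 6`:
(P2) `dim Eig(s_B^*|H¹(B(ℂ); ℂ), ζ₇^a) ≤ 12` — the Chevalley–Weil multiplicity (Patel–Zhang
Lemma 2.9 / Cor. 2.10 / Lemma 5.1: every non-trivial character of `ℤ/7` has multiplicity EXACTLY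
`h = 12` in `H¹(C, ℚ)_{nt} = H¹(B, ℚ)`; Schoen Lemma 1.5 with §3); and
(P3) ONE non-zero algebraic class in `E_a = Eig((2·𝟙_B + s_B)^*|H¹², (2 + ζ₇^a)¹²)` — the class of
Schoen's cycle `z_χ` pushed to `B` (Thm. 2.0 for `r = 0`, p. 13, and Cor. 3.1, p. 25: "`Q · z_χ ≠ 0`
… `U ⊗ ℚ_ℓ(μ_m)` is generated by the eigenvectors `z_χ`").
Indeed `E_a` is then a line (`finrank_eigenspace_two_add_pow_twelve_le_one` with `s_B⁷ = 𝟙`,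
`kerComponent_restrict_comp_pow_seven`) through an algebraic class.  Neither (P2) nor (P3) is
proved in the tree: (P2) needs `H¹(J(C)) ≅ H¹(C)` (the named fact
`Motives.isIso_bettiCohomology_map_abelJacobi`) and the Lefschetz numbers of the free `σʲ`; (P3) is
the geometric heart of Schoen's theorem (symmetric powers, the Abel–Jacobi `ℙ⁶`-bundle, `c₆ ≠ 0`,
Poincaré's formula, Lieberman).
[cite: Schoen1988HodgeWeil, Thm 2.0 (p. 11, proof p. 13) and Cor 3.1 (pp. 24–25)]
[cite: PatelZhang2025PrymHodge, Lemma 2.9, Cor 2.10, Lemma 5.1, Thm 5.3] -/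
theorem Schoen1988_cyclicPrym_weilClasses_algebraic_degreeSeven_of_finrank_le_of_exists
    (hP2 : ∀ (C : SchemeOver ℂ) (𝒥 : Jacobian C) (σ : C ⟶ C),
      IsSmoothProjective 1 C → 𝒥.J.dim = 43 →
      σ ≫ σ ≫ σ ≫ σ ≫ σ ≫ σ ≫ σ = 𝟙 C → (∀ P : ComplexPoints C, P ≫ σ ≠ P) →
      ∀ (s eN : 𝒥.J ⟶ 𝒥.J), s = 𝒥.pushforward 𝒥 σ →
      eN = 𝟙 𝒥.J + s + s ≫ s + s ≫ s ≫ s + s ≫ s ≫ s ≫ s + s ≫ s ≫ s ≫ s ≫ s +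
        s ≫ s ≫ s ≫ s ≫ s ≫ s →
      ∀ (sB : AbelianVariety.kerComponent eN ⟶ AbelianVariety.kerComponent eN),
        sB ≫ AbelianVariety.kerComponentι eN = AbelianVariety.kerComponentι eN ≫ s →
      ∀ a : ℕ, 1 ≤ a → a ≤ 6 →
        Module.finrank ℂ
          (Module.End.eigenspace (complexBetti.map sB.hom.hom.hom 1).hom
            (Complex.exp (2 * (Real.pi : ℂ) * Complex.I / 7) ^ a)) ≤ 12)
    (hP3 : ∀ (C : SchemeOver ℂ) (𝒥 : Jacobian C) (σ : C ⟶ C),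
      IsSmoothProjective 1 C → 𝒥.J.dim = 43 →
      σ ≫ σ ≫ σ ≫ σ ≫ σ ≫ σ ≫ σ = 𝟙 C → (∀ P : ComplexPoints C, P ≫ σ ≠ P) →
      ∀ (s eN : 𝒥.J ⟶ 𝒥.J), s = 𝒥.pushforward 𝒥 σ →
      eN = 𝟙 𝒥.J + s + s ≫ s + s ≫ s ≫ s + s ≫ s ≫ s ≫ s + s ≫ s ≫ s ≫ s ≫ s +
        s ≫ s ≫ s ≫ s ≫ s ≫ s →
      ∀ (sB : AbelianVariety.kerComponent eN ⟶ AbelianVariety.kerComponent eN),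
        sB ≫ AbelianVariety.kerComponentι eN = AbelianVariety.kerComponentι eN ≫ s →
      ∀ a : ℕ, 1 ≤ a → a ≤ 6 →
        ∃ z ∈ Module.End.eigenspace
            (complexBetti.map ((2 : ℤ) • 𝟙 (AbelianVariety.kerComponent eN) + sB).hom.hom.hom 12).hom
            ((2 + Complex.exp (2 * (Real.pi : ℂ) * Complex.I / 7) ^ a) ^ 12),
          z ≠ 0 ∧ z ∈ algebraicClasses (AbelianVariety.kerComponent eN).X 6) :
    Schoen1988_cyclicPrym_weilClasses_algebraic_degreeSeven := by
  intro C 𝒥 σ hC h43 hσ hfree s eN hs heN sB hsB a ha₁ ha₆ c hc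
  haveI := finite_complexBetti_abelianVariety (AbelianVariety.kerComponent eN) 12
  have h7 := kerComponent_restrict_comp_pow_seven heN hsB
  have hle := finrank_eigenspace_two_add_pow_twelve_le_one isPrimitiveRoot_exp_two_pi_I_div_seven
    h7 ha₁ ha₆     (hP2 C 𝒥 σ hC h43 hσ hfree s eN hs heN sB hsB a ha₁ ha₆)
  obtain ⟨z, hz, hz0, hza⟩ := hP3 C 𝒥 σ hC h43 hσ hfree s eN hs heN sB hsB a ha₁ ha₆
  exact le_of_finrank_le_one_of_mem hle hz hz0 hza hc

/-- **Three cycles suffice** (complex conjugation): in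
`Schoen1988_cyclicPrym_weilClasses_algebraic_degreeSeven_of_finrank_le_of_exists` the input (P3)
is needed only for `a = 1, 2, 3` — the conjugate `c̄` of a non-zero algebraic class `c ∈ E_{7-a}` is
a non-zero algebraic class in `E_a` (`conjClass_mem_eigenspace_complexBetti_map`,
`starRingEnd_two_add_zeta7_pow`, `conjClass_mem_algebraicClasses_abelianVariety`), as Schoen's
`z_χ̄ = z̄_χ`. [cite: Schoen1988HodgeWeil, §2 p. 13 (proof of Thm. 2.0, case r = 0)] -/
theorem Schoen1988_cyclicPrym_weilClasses_algebraic_degreeSeven_of_finrank_le_of_exists_three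
    (hP2 : ∀ (C : SchemeOver ℂ) (𝒥 : Jacobian C) (σ : C ⟶ C),
      IsSmoothProjective 1 C → 𝒥.J.dim = 43 →
      σ ≫ σ ≫ σ ≫ σ ≫ σ ≫ σ ≫ σ = 𝟙 C → (∀ P : ComplexPoints C, P ≫ σ ≠ P) →
      ∀ (s eN : 𝒥.J ⟶ 𝒥.J), s = 𝒥.pushforward 𝒥 σ →
      eN = 𝟙 𝒥.J + s + s ≫ s + s ≫ s ≫ s + s ≫ s ≫ s ≫ s + s ≫ s ≫ s ≫ s ≫ s +
        s ≫ s ≫ s ≫ s ≫ s ≫ s →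
      ∀ (sB : AbelianVariety.kerComponent eN ⟶ AbelianVariety.kerComponent eN),
        sB ≫ AbelianVariety.kerComponentι eN = AbelianVariety.kerComponentι eN ≫ s →
      ∀ a : ℕ, 1 ≤ a → a ≤ 6 →
        Module.finrank ℂ
          (Module.End.eigenspace (complexBetti.map sB.hom.hom.hom 1).hom
            (Complex.exp (2 * (Real.pi : ℂ) * Complex.I / 7) ^ a)) ≤ 12)
    (hP3 : ∀ (C : SchemeOver ℂ) (𝒥 : Jacobian C) (σ : C ⟶ C),
      IsSmoothProjective 1 C → 𝒥.J.dim = 43 →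
      σ ≫ σ ≫ σ ≫ σ ≫ σ ≫ σ ≫ σ = 𝟙 C → (∀ P : ComplexPoints C, P ≫ σ ≠ P) →
      ∀ (s eN : 𝒥.J ⟶ 𝒥.J), s = 𝒥.pushforward 𝒥 σ →
      eN = 𝟙 𝒥.J + s + s ≫ s + s ≫ s ≫ s + s ≫ s ≫ s ≫ s + s ≫ s ≫ s ≫ s ≫ s +
        s ≫ s ≫ s ≫ s ≫ s ≫ s →
      ∀ (sB : AbelianVariety.kerComponent eN ⟶ AbelianVariety.kerComponent eN),
        sB ≫ AbelianVariety.kerComponentι eN = AbelianVariety.kerComponentι eN ≫ s →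
      ∀ a : ℕ, 1 ≤ a → a ≤ 3 →
        ∃ z ∈ Module.End.eigenspace
            (complexBetti.map ((2 : ℤ) • 𝟙 (AbelianVariety.kerComponent eN) + sB).hom.hom.hom 12).hom
            ((2 + Complex.exp (2 * (Real.pi : ℂ) * Complex.I / 7) ^ a) ^ 12),
          z ≠ 0 ∧ z ∈ algebraicClasses (AbelianVariety.kerComponent eN).X 6) :
    Schoen1988_cyclicPrym_weilClasses_algebraic_degreeSeven := by
  refine Schoen1988_cyclicPrym_weilClasses_algebraic_degreeSeven_of_finrank_le_of_exists hP2 ?_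
  intro C 𝒥 σ hC h43 hσ hfree s eN hs heN sB hsB a ha₁ ha₆
  by_cases ha3 : a ≤ 3
  · exact hP3 C 𝒥 σ hC h43 hσ hfree s eN hs heN sB hsB a ha₁ ha3
  · -- `a ∈ {4, 5, 6}`: conjugate the class for `7 - a ∈ {1, 2, 3}`
    obtain ⟨z, hz, hz0, hza⟩ := hP3 C 𝒥 σ hC h43 hσ hfree s eN hs heN sB hsB (7 - a) (by omega)
      (by omega)
    refine ⟨conjClass (Motives.ComplexPoints (AbelianVariety.kerComponent eN).X) 12 z, ?_,
      conjClass_ne_zero hz0, conjClass_mem_algebraicClasses_abelianVariety (p := 6) hza⟩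
    have h := conjClass_mem_eigenspace_complexBetti_map hz
    rwa [starRingEnd_two_add_zeta7_pow isPrimitiveRoot_exp_two_pi_I_div_seven (7 - a) (by omega)
      (by omega),
      show 7 - (7 - a) = a by omega] at h

end Assembly

end Literature.AlgebraicGeometry.HodgeTheory

end
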